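import Literature.NumberTheory.LFunctions.Zhang2022.DHMenuConsistentWorld
import Literature.NumberTheory.LFunctions.ConditionalPageTheorem
import Literature.NumberTheory.LFunctions.MertensElementary
import Mathlib.NumberTheory.DirichletCharacter.Bounds

/-!
# Zhang (2022), rung F-S3, family B-dh — E-18e: the CENSUS companion `MenuCensusConsistent`
# (the term-(iii) watch rows of B-dh/MENU-CENSUS.md that are TYPED IN TREE, read over the world `W(D, χ)`)

Y. Zhang, *Discrete mean estimates and the Landau–Siegel zero*, arXiv:2211.02515v1 [Zhang2022LandauSiegel] — an unrefereed
manuscript under adjudication. **The programme SEARCHES and TYPES; no claim about Landau–Siegel zeros, Theorems 1–2 of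
arXiv:2211.02515 or a repaired Margin232 until a kernel theorem says so.** Nothing in this file is a statement about a
Dirichlet `L`-function: `DH.world D χ` (`DHChainBarrier`, p461081/p461386) is abstract zero/value DATA and every theorem
below is elementary bookkeeping about that data. Cell `landau-siegel` (pub/landau-siegel/), sub-cells B-dh / E; written by
ls-Bdh-typer-1 g3 as pre-emptible idle filler on the GO of the census's owner ls-Bdh-plan g2 (cell bus 2026-08-27T01:05:46Z).

## What this companion is, and what it is not (planner's letter, verbatim in substance)

«Census rows are TERM-(iii) WATCH rows screened in B-dh/MENU-CENSUS.md, NOT rows of the word's menu `M_typed ∪ M_primes`;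
this theorem certifies the census cells MET/VACUOUS for the typed rows; the word's scope is unchanged.» The B-dh word of record
«KILL(B-dh) inside Σ_menu» (UNCONDITIONAL over `M_typed ∪ M_primes`, `DH.certificate_holds` p478764) carries the term (iii)
«any new/stronger menu row re-opens the certificate»; B-dh/MENU-CENSUS.md (ls-Bdh-plan g2; v1.2 889aefbb878458ed, 19 rows)
screens the DH-currency rows tabled by sub-cell C since the word against the certificate world `W(D, χ)` and found
0 re-openings — by SEAT ARITHMETIC (single lineage, uncertified). THIS FILE turns that arithmetic into kernel theorems for
every census row whose statement EXISTS as a tree declaration and reads on `W`'s fields (zeros `mult`, value `LOne`): one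
structure `ZeroWorld.MenuCensus` with one field per such decl, read VERBATIM (`L(ρ,χ) = 0 ↦ w.IsZero q χ ρ`,
`L(1,χ)`, `(L(1,χ)).re ↦ w.LOne q χ`), the decls' own existential constants/thresholds mirrored as PARAMETERS and quantified
ONCE before `∀ D` in `MenuCensusConsistent`, and `menuCensusConsistent_holds`.

RENDERED (census row · tree decl · cell in the census · how `W` meets it):
* row 1 · `ralaivaosaonaRazakarinoro2026_theorem1` (ExplicitSiegelZeroBoundImaginaryQuadratic.lean; JNT 281 (2026) Thm 1:
  odd primitive quadratic `χ` mod `d > 3·10⁸`, real zero `β > 0` ⇒ `1 − β > 6.035/√d`) · MET · a real zero of a PRIMITIVE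
  slot of `W` lives on the slot `(D, χ)` (`IsExcSlot.level_eq`) and is `β₁ = 1 − δ(𝓛)` or `1 − β₁` (`isZero_ofReal_iff`);
  `δ(𝓛) = 2/(3𝓛²⁰²²) > 6.035·e^{−𝓛/2} = 6.035/√D` for `𝓛 = log D ≥ 43 250` (`const_mul_exp_neg_lt_delta`, the census's
  «crossing ≈ 43165 < 𝓛₀»), and `1 − (1 − β₁) = β₁ > ½`.
* row 2 · `Khale2024_zeroFreeRegion` (VinogradovKorobovDirichlet.lean; explicit VK region, `|t| ≥ 10`) · MET · `W`'s zeros with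
  `|Im| ≥ 10` are fence points, `Re = ½ < 1 − 1/(10.5 log q + …)` since the denominator exceeds `10.5 log 3 > 2`.
* row 9 · `basakPratt2026_theorem12` (ConditionalPageTheorem.lean; conditional Page theorem: `H_f` on `𝒮(Q²)` ⇒ at most one
  `χ ∈ 𝒮(Q)` with a real zero in `[1 − (log Q)^{−ε}, 1)`) · MET · its hypothesis and conclusion predicates
  `ShrinkingDiskRealZeros` / `AtMostOneRealZeroNear` are re-read over the world (`ZeroWorld.shrinkingDiskRealZeros` /
  `.atMostOneRealZeroNear`, verbatim with `L(β,χ) = 0 ↦ w.IsZero`); on `W` the conclusion holds OUTRIGHT at every `Q`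
  (`Q₀ := 1`): two distinct primitive quadratic characters cannot both carry a real zero (both would be the slot `(D, χ)`).
* row 16 · `goldfeldSchinzel1975_corollary` (SiegelZeroFormSumAsymptotic.lean; `∀ η > 0 ∃ c(η)`: odd ⇒
  `1 − β ≥ (6/π − η)/√d`, even ⇒ `1 − β ≥ (6/π² − η) log d/√d`) · MET on both parities with `c(η) := 0` ·
  `(6/π − η)·e^{−𝓛/2} < δ(𝓛)` and `(6/π² − η)·𝓛·e^{−𝓛/2} < δ(𝓛)` for `𝓛 ≥ 43 250` (`const_mul_exp_neg_lt_delta`,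
  `const_mul_L_mul_exp_neg_lt_delta`; the even line is the census's LARGEST crossing `43183.7 < 𝓛₀`), the other real zero
  `1 − β₁` trivially.
* row 17 · `pintz1976_theorem3`, `pintz1976_theorem3_schinzel`, `pintz1976_theorem5` (GreatestRealZeroElementary.lean; `∀ ε ∃ D₀`:
  greatest real zero `1 − δ` has `δ ≥ (12/π − ε)/√D`, resp. `> (16/π − ε)/√D`; Thm 5: `L(1,χ) ≤ 1/log²D` ⇒ a real zero in
  `[1 − 1/log D, 1)` and `L(1)/δ ≤ C·(log D log log D/log(1/(5L(1) log D)))²`, `∃ C ∃ D₀`) · MET with `D₀ := 3`, `C := 1` ·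
  Thm 3 / Schinzel as row 16 (`16/π < 20`); Thm 5: on `W` the hypothesis `LOne ≤ 1/log² q` singles out the induced slots
  (elsewhere `LOne = 1 > 1/log² q` for `q ≥ 3`), a primitive one is `(D, χ)` with `LOne = λ = 1/(2𝓛²⁰²²) ≤ 1/𝓛²`; `β₁ = 1 − δ ≥
  1 − 1/𝓛` exists; the greatest real zero is `β₁` (`1 − β₁ < β₁`), `λ/δ = 3/4`, and
  `(𝓛 log 𝓛/log(1/(5λ𝓛)))² ≥ (𝓛/2021)² ≥ 400 ≥ 3/4` because `1/(5λ𝓛) = (2/5)𝓛²⁰²¹ ≤ 𝓛²⁰²¹`. `IsGreatestRealZero` is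
  re-read over the world as `ZeroWorld.isGreatestRealZero` (verbatim).

NOT RENDERED (with the reason; census numbering v1.2): rows 4/5/6 Morrill–Trudgian 2020 / Bordignon 2019 / 2020 — no tree
declaration (`lean search` 2026-08-27: none); rows 7/8/15 Táfula — currency `L′/L(1,χ)`, not a field of `ZeroWorld` (OUTSIDE by
field; MET only under the Hadamard dictionary, seat arithmetic); rows 10/11 Bellotti–Puglisi — class-number currency /
VACUOUS, no tree decl known; row 12 Thorner QUE dichotomy — automorphic hypothesis, OUTSIDE; row 13 explicit PNT-AP rows —
`M_primes`, met BY FIAT in `primeWorld` (p473947); row 14 — inside `M_typed` by name; row 1 part `_theorem2` — class number of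
an imaginary quadratic FIELD (`NumberField.classNumber`), not a world field; row 19 Jutila 1977 — not typed. Row 18
`pintz1976_theorem4` — a TRUE-PRIME-VALUE sum `Σ_{p ≤ D²}(1 + χ(p))/p` over the actual character next to the world's value
field — IS rendered, in Part 2 (§7, `ZeroWorld.MenuCensusRow18` / `MenuCensusRow18Consistent` / `_holds`): as an `∃C`-row it
is met by Skolem choice via the tree's elementary Mertens bound `MertensBound.sum_inv_prime_le` (Part 1's first filing,
p481895, said «would need a Mertens bound the tree does not have» — wrong, corrected here; cell bus ERRATUM 2026-08-27T01:2xZ).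

SCOPE (this file moves no word): a COMPANION outside the word's scope, like E-18c/E-18d; no REF-E read required. No number in
this file is load-bearing beyond the displayed `exp`/`log` lines at `𝓛 ≥ 43 250` (the master line `c·𝓛ⁿ < e^{𝓛/2}` is the
one of `DHMenuLines` (p459347), re-proved here privately because it is private there); no certificate, no float.

«The programme SEARCHES and TYPES; no claim about Landau–Siegel zeros, Theorems 1–2 of arXiv:2211.02515 or a repaired
Margin232 until a kernel theorem says so.»

## References

* [Zhang2022LandauSiegel] Y. Zhang, *Discrete mean estimates and the Landau–Siegel zero*, arXiv:2211.02515v1 (2022), §2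
  Assumption (A).
* [RalaivaosaonaRazakarinoro2026] Theorem 1 p. 796; [Khale2024] Theorem 1.1 (1.2); [BasakPratt2026] Theorem 1.2 (+ §1 `H_f`);
  [GoldfeldSchinzel1975] Corollary p. 572; [Pintz1976ElementaryII] Theorem 3 (1.24), footnote (2) p. 277, Theorem 5 (1.30)–(1.31)
  — each as TYPED in the tree files named above (this file reads the typed statements, not the papers).
* pub/landau-siegel/B-dh/MENU-CENSUS.md v1.2 (rows 1, 2, 9, 16, 17, 18); B-dh/KILL-draft.md v1.4.5 §1 term (iii);
  [HardyWright2008] Thm 427 (Mertens, as proved in `MertensElementary`).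
-/

noncomputable section

open scoped Classical
open Complex Filter Topology

namespace Literature.NumberTheory.LFunctions.Zhang2022.DH

/-! ## 1. The census rows over a world -/

namespace ZeroWorld

variable (w : ZeroWorld)

/-- Basak–Pratt's hypothesis `H_f` on `𝒮(X)` over the world (= `BasakPratt2026.ShrinkingDiskRealZeros f X` with
`L(s,χ) = 0 ↦ w.IsZero q χ s`). [cite: BasakPratt2026, §1 Hypothesis H_f and Theorem 1.2] -/
def shrinkingDiskRealZeros (f : ℝ → ℝ) (X : ℝ) : Prop :=
  ∀ (q : ℕ) [NeZero q], (q : ℝ) ≤ X → ∀ χ : DirichletCharacter ℂ q, χ.IsQuadratic → χ.IsPrimitive →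
    ∀ s : ℂ, w.IsZero q χ s → ‖s - 1‖ < 1 / f q → s.im = 0

/-- Basak–Pratt's conclusion "`#{χ ∈ 𝒮(Q) : L(s,χ) has a real zero in [1 − w, 1)} ≤ 1`" over the world
(= `BasakPratt2026.AtMostOneRealZeroNear Q w` with `L(β,χ) = 0 ↦ w.IsZero q χ β`). [cite: BasakPratt2026, Theorem 1.2 (conclusion)] -/
def atMostOneRealZeroNear (Q v : ℝ) : Prop :=
  (∀ (q₁ q₂ : ℕ) [NeZero q₁] [NeZero q₂] (χ₁ : DirichletCharacter ℂ q₁)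
      (χ₂ : DirichletCharacter ℂ q₂), q₁ ≠ q₂ → (q₁ : ℝ) ≤ Q → (q₂ : ℝ) ≤ Q →
      χ₁.IsQuadratic → χ₁.IsPrimitive → χ₂.IsQuadratic → χ₂.IsPrimitive →
      ∀ β₁ β₂ : ℝ, w.IsZero q₁ χ₁ β₁ → w.IsZero q₂ χ₂ β₂ → β₁ < 1 → β₂ < 1 →
        β₁ < 1 - v ∨ β₂ < 1 - v) ∧
  (∀ (q : ℕ) [NeZero q] (χ₁ χ₂ : DirichletCharacter ℂ q), χ₁ ≠ χ₂ → (q : ℝ) ≤ Q →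
      χ₁.IsQuadratic → χ₁.IsPrimitive → χ₂.IsQuadratic → χ₂.IsPrimitive →
      ∀ β₁ β₂ : ℝ, w.IsZero q χ₁ β₁ → w.IsZero q χ₂ β₂ → β₁ < 1 → β₂ < 1 →
        β₁ < 1 - v ∨ β₂ < 1 - v)

/-- "`β` is the greatest real zero of `L(s,χ)` in `(−∞,1)`" over the world (= `IsGreatestRealZero χ β` of
`GreatestRealZeroElementary` with `L(β,χ) = 0 ↦ w.IsZero q χ β`). [cite: Pintz1976ElementaryII, Theorem 2 p. 276] -/
def isGreatestRealZero (q : ℕ) (χ : DirichletCharacter ℂ q) (β : ℝ) : Prop :=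
  β < 1 ∧ w.IsZero q χ β ∧ ∀ β' : ℝ, β < β' → β' < 1 → ¬ w.IsZero q χ β'

/-- **THE CENSUS MENU over a world**, thresholds/constants as PARAMETERS (quantified ONCE, before `∀ D`, in
`MenuCensusConsistent`): one field per census row of B-dh/MENU-CENSUS.md v1.2 that is TYPED IN TREE and reads on the world's
fields, each the tree decl read verbatim. These are term-(iii) WATCH rows, not rows of the word's menu.
[cite: Zhang2022LandauSiegel, §2 Assumption (A)] -/
structure MenuCensus (c₁₆ : ℝ → ℕ) (D₃ D₃' : ℝ → ℕ) (C₅ : ℝ) (D₅ : ℕ) (Q₉ : (ℝ → ℝ) → ℝ → ℝ) : Prop where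
  /-- census row 1 = `ralaivaosaonaRazakarinoro2026_theorem1`. -/
  rowRR1 : ∀ (d : ℕ) [NeZero d], 300000000 < d → ∀ χ : DirichletCharacter ℂ d,
    χ.IsQuadratic → χ.IsPrimitive → χ.Odd →
      ∀ β : ℝ, 0 < β → w.IsZero d χ β → 6.035 / Real.sqrt d < 1 - β
  /-- census row 2 = `Khale2024_zeroFreeRegion`. -/
  rowKhale : ∀ (q : ℕ) [NeZero q], 3 ≤ q → ∀ (χ : DirichletCharacter ℂ q) (s : ℂ), 10 ≤ |s.im| →
    1 - 1 / (10.5 * Real.log q +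
        61.5 * Real.log |s.im| ^ (2 / 3 : ℝ) * Real.log (Real.log |s.im|) ^ (1 / 3 : ℝ)) ≤ s.re →
      ¬ w.IsZero q χ s
  /-- census row 9 = `basakPratt2026_theorem12` (its `∃ Q₀ ≥ 1` for each `ν, ε` is the parameter `Q₉ ν ε`). -/
  rowBP12 : ∀ ν : ℝ → ℝ, (∀ x, 0 < ν x) → Tendsto ν atTop (nhds 0) →
    MonotoneOn (BasakPratt2026.growth ν) (Set.Ioi 1) → Tendsto (BasakPratt2026.growth ν) atTop atTop →
    ∀ ε : ℝ, 0 < ε → ∀ Q : ℝ, Q₉ ν ε ≤ Q →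
      w.shrinkingDiskRealZeros (BasakPratt2026.growth ν) (Q ^ 2) → w.atMostOneRealZeroNear Q (Real.log Q ^ (-ε))
  /-- census row 16 = `goldfeldSchinzel1975_corollary` (its `∃ c` for each `η` is the parameter `c₁₆ η`). -/
  rowGS75 : ∀ η : ℝ, 0 < η → ∀ (D' : ℕ) [NeZero D'], c₁₆ η < D' →
    ∀ χ : DirichletCharacter ℂ D', χ.IsQuadratic → χ.IsPrimitive →
      ∀ β : ℝ, w.IsZero D' χ (β : ℂ) →
        (χ.Odd → (6 / Real.pi - η) / Real.sqrt D' ≤ 1 - β) ∧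
        (χ.Even → (6 / Real.pi ^ 2 - η) * Real.log D' / Real.sqrt D' ≤ 1 - β)
  /-- census row 17 = `pintz1976_theorem3` (its `∃ D₀` for each `ε` is the parameter `D₃ ε`). -/
  rowPintz3 : ∀ ε : ℝ, 0 < ε → ∀ (D' : ℕ) [NeZero D'], D₃ ε ≤ D' →
    ∀ χ : DirichletCharacter ℂ D', χ.IsQuadratic → χ.IsPrimitive →
      ∀ β : ℝ, w.isGreatestRealZero D' χ β → (12 / Real.pi - ε) / Real.sqrt D' ≤ 1 - β
  /-- census row 17 = `pintz1976_theorem3_schinzel` (its `∃ D₀` for each `ε` is the parameter `D₃' ε`). -/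
  rowPintz3S : ∀ ε : ℝ, 0 < ε → ∀ (D' : ℕ) [NeZero D'], D₃' ε < D' →
    ∀ χ : DirichletCharacter ℂ D', χ.IsQuadratic → χ.IsPrimitive →
      ∀ β : ℝ, w.isGreatestRealZero D' χ β → (16 / Real.pi - ε) / Real.sqrt D' < 1 - β
  /-- census row 17 = `pintz1976_theorem5` (its `∃ C ∃ D₀` are the parameters `C₅, D₅`; `(L(1,χ)).re ↦ w.LOne`). -/
  rowPintz5 : ∀ (D' : ℕ) [NeZero D'], D₅ ≤ D' →
    ∀ χ : DirichletCharacter ℂ D', χ.IsQuadratic → χ.IsPrimitive →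
      w.LOne D' χ ≤ 1 / Real.log D' ^ 2 →
        (∃ β : ℝ, 1 - 1 / Real.log D' ≤ β ∧ β < 1 ∧ w.IsZero D' χ (β : ℂ)) ∧
        ∀ β : ℝ, w.isGreatestRealZero D' χ β →
          w.LOne D' χ / (1 - β) ≤
            C₅ * (Real.log D' * Real.log (Real.log D') /
                  Real.log (1 / (5 * w.LOne D' χ * Real.log D'))) ^ 2

end ZeroWorld

/-! ## 2. The certificate statement (E-18e) -/

/-- **`MenuCensusConsistent` (B-DH-W, census companion E-18e).** There are thresholds/constants — `c₁₆ : ℝ → ℕ`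
(Goldfeld–Schinzel), `D₃, D₃' : ℝ → ℕ` (Pintz Thm 3 / Schinzel), `C₅, D₅` (Pintz Thm 5), `Q₉` with `Q₉ ν ε ≥ 1` (Basak–Pratt)
— chosen ONCE, such that for every modulus `D` with `log D ≥ 43 250` and every primitive quadratic `χ ≠ χ₀` mod `D` the
(A)-world `world D χ` satisfies the census menu. The census rows are term-(iii) WATCH rows, NOT rows of the word's menu; the
word's scope is unchanged. [cite: Zhang2022LandauSiegel, §2 Assumption (A)] -/
def MenuCensusConsistent : Prop :=
  ∃ c₁₆ : ℝ → ℕ, ∃ D₃ D₃' : ℝ → ℕ, ∃ C₅ : ℝ, ∃ D₅ : ℕ, ∃ Q₉ : (ℝ → ℝ) → ℝ → ℝ, (∀ ν ε, 1 ≤ Q₉ ν ε) ∧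
    ∀ (D : ℕ) [NeZero D] (χ : DirichletCharacter ℂ D), χ.IsPrimitive → χ.IsQuadratic → χ ≠ 1 →
      (43250 : ℝ) ≤ Real.log D → (world D χ).MenuCensus c₁₆ D₃ D₃' C₅ D₅ Q₉

/-! ## 3. Lines at `𝓛 ≥ 43 250`: explicit `c/√D`- and `c log D/√D`-floors lie below `δ(𝓛)` -/

section Lines

open DHMenuLines

/-- `e^{10} > 22 026`. [folklore] -/
private theorem exp_ten_gt : (22026 : ℝ) < Real.exp 10 := by
  have h1 : (2.7182818283 : ℝ) < Real.exp 1 := Real.exp_one_gt_d9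
  have h10 : Real.exp 10 = Real.exp 1 ^ 10 := by
    rw [← Real.exp_nat_mul]; norm_num
  rw [h10]
  calc (22026 : ℝ) < 2.7182818283 ^ 10 := by norm_num
    _ ≤ Real.exp 1 ^ 10 := pow_le_pow_left₀ (by norm_num) h1.le 10

/-- `e^{0.68} > 1.9737` (six Taylor terms). [folklore] -/
private theorem exp_068_gt : (1.9737 : ℝ) < Real.exp 0.68 := by
  have h := Real.sum_le_exp_of_nonneg (show (0 : ℝ) ≤ 0.68 by norm_num) 6
  have hs : ∑ i ∈ Finset.range 6, (0.68 : ℝ) ^ i / (Nat.factorial i : ℝ) =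
      1 + 0.68 + 0.68 ^ 2 / 2 + 0.68 ^ 3 / 6 + 0.68 ^ 4 / 24 + 0.68 ^ 5 / 120 := by
    norm_num [Finset.sum_range_succ, Nat.factorial]
  rw [hs] at h
  have : (1.9737 : ℝ) < 1 + 0.68 + 0.68 ^ 2 / 2 + 0.68 ^ 3 / 6 + 0.68 ^ 4 / 24 + 0.68 ^ 5 / 120 := by
    norm_num
  linarith

/-- `log 43 250 < 10.68` (`e^{10.68} = e^{10}·e^{0.68} > 22026·1.9737 > 43250`). [folklore] -/
private theorem log_43250_lt : Real.log 43250 < 10.68 := by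
  rw [Real.log_lt_iff_lt_exp (by norm_num)]
  have h : Real.exp 10.68 = Real.exp 10 * Real.exp 0.68 := by
    rw [← Real.exp_add]; norm_num
  rw [h]
  calc (43250 : ℝ) < 22026 * 1.9737 := by norm_num
    _ < Real.exp 10 * Real.exp 0.68 := mul_lt_mul'' exp_ten_gt exp_068_gt (by norm_num) (by norm_num)

/-- Concavity bound `log L ≤ 10.68 + (L − 43250)/43250` for `L ≥ 43 250`. [folklore] -/
private theorem log_le_lin {L : ℝ} (hL : 43250 ≤ L) : Real.log L ≤ 10.68 + (L - 43250) / 43250 := by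
  have hL0 : 0 < L := by linarith
  have hsplit : Real.log L = Real.log 43250 + Real.log (L / 43250) := by
    rw [← Real.log_mul (by norm_num) (by positivity)]
    congr 1; field_simp
  have hx : Real.log (L / 43250) ≤ L / 43250 - 1 := Real.log_le_sub_one_of_pos (by positivity)
  have h43 := log_43250_lt
  rw [hsplit]
  have : L / 43250 - 1 = (L - 43250) / 43250 := by field_simp
  linarith

/-- Master line (as in `DHMenuLines`, private there): `c·Lⁿ < e^{L/2}` on `[43 250, ∞)` under the budget
`c − 1 + 10.68·n ≤ 21 624`, `n ≤ 2023`. [folklore] -/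
private theorem mul_pow_lt_exp_half {L c : ℝ} {n : ℕ} (hL : 43250 ≤ L) (hc : 0 < c) (hn : (n : ℝ) ≤ 2023)
    (hbudget : c - 1 + 10.68 * n ≤ 21624) : c * L ^ n < Real.exp (L / 2) := by
  have hL0 : 0 < L := by linarith
  have hpos : 0 < c * L ^ n := by positivity
  rw [← Real.exp_log hpos, Real.exp_lt_exp, Real.log_mul hc.ne' (by positivity), Real.log_pow]
  have hlogc : Real.log c ≤ c - 1 := Real.log_le_sub_one_of_pos hc
  have hlogL := log_le_lin hL
  have hn0 : (0 : ℝ) ≤ n := Nat.cast_nonneg n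
  have h1 : (n : ℝ) * Real.log L ≤ n * (10.68 + (L - 43250) / 43250) :=
    mul_le_mul_of_nonneg_left hlogL hn0
  have h2 : (n : ℝ) * ((L - 43250) / 43250) ≤ 2023 * ((L - 43250) / 43250) :=
    mul_le_mul_of_nonneg_right hn (by apply div_nonneg <;> linarith)
  nlinarith

/-- **Census line (c1): `c·e^{−L/2} < δ(L)` for `0 < c ≤ 20`, `L ≥ 43 250`** — every `c/√D`-floor for `1 − β` with
`c ≤ 20` (Ralaivaosaona–Razakarinoro `6.035`, Goldfeld–Schinzel `6/π`, Pintz `12/π`, Schinzel `16/π`) lies below the world's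
`δ = 2/(3𝓛²⁰²²)` (`1.5c·L²⁰²² < e^{L/2}`). [cite: RalaivaosaonaRazakarinoro2026, Theorem 1] -/
theorem const_mul_exp_neg_lt_delta {L c : ℝ} (hL : 43250 ≤ L) (hc0 : 0 < c) (hc : c ≤ 20) :
    c * Real.exp (-(L / 2)) < delta L := by
  have hL0 : 0 < L := by linarith
  have hmain : (3 / 2 * c) * L ^ 2022 < Real.exp (L / 2) :=
    mul_pow_lt_exp_half hL (by positivity) (by norm_num) (by linarith)
  have hE : 0 < Real.exp (L / 2) := Real.exp_pos _
  unfold delta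
  rw [Real.exp_neg, lt_div_iff₀ (by positivity)]
  rw [show c * (Real.exp (L / 2))⁻¹ * (3 * L ^ 2022) = 2 * ((3 / 2 * c) * L ^ 2022 / Real.exp (L / 2)) by ring]
  have h1 : (3 / 2 * c) * L ^ 2022 / Real.exp (L / 2) < 1 := (div_lt_one hE).mpr hmain
  linarith

/-- **Census line (c2): `c·L·e^{−L/2} < δ(L)` for `0 < c ≤ 12`, `L ≥ 43 250`** — every `c·log D/√D`-floor with `c ≤ 12`
(Goldfeld–Schinzel's even `6/π²`) lies below `δ` (`1.5c·L²⁰²³ < e^{L/2}`; the census's largest crossing, `43183.7`, is this line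
at `c = 6/π²`). [cite: GoldfeldSchinzel1975, Corollary p. 572] -/
theorem const_mul_L_mul_exp_neg_lt_delta {L c : ℝ} (hL : 43250 ≤ L) (hc0 : 0 < c) (hc : c ≤ 12) :
    c * L * Real.exp (-(L / 2)) < delta L := by
  have hL0 : 0 < L := by linarith
  have hmain : (3 / 2 * c) * L ^ 2023 < Real.exp (L / 2) :=
    mul_pow_lt_exp_half hL (by positivity) (by norm_num) (by linarith)
  have hE : 0 < Real.exp (L / 2) := Real.exp_pos _
  unfold delta
  rw [Real.exp_neg, lt_div_iff₀ (by positivity)]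
  rw [show c * L * (Real.exp (L / 2))⁻¹ * (3 * L ^ 2022) = 2 * ((3 / 2 * c) * L ^ 2023 / Real.exp (L / 2)) by ring]
  have h1 : (3 / 2 * c) * L ^ 2023 / Real.exp (L / 2) < 1 := (div_lt_one hE).mpr hmain
  linarith

/-- `δ(L) < 1/2` for `L ≥ 43 250`. [cite: BenliGoelTwissZaman2025, Corollary 1.1] -/
theorem delta_lt_half {L : ℝ} (hL : 43250 ≤ L) : delta L < 1 / 2 := by
  have h := bgtz_binder hL
  have hL0 : (0 : ℝ) < 10 * L := by linarith
  have : 1 / (10 * L) ≤ 1 / 2 := by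
    rw [div_le_div_iff₀ hL0 (by norm_num)]; linarith
  linarith

/-- `log 3 > 1`. [folklore] -/
private theorem one_lt_log_three : (1 : ℝ) < Real.log 3 := by
  rw [Real.lt_log_iff_exp_lt (by norm_num)]
  exact lt_trans Real.exp_one_lt_d9 (by norm_num)

/-- `log L > 0` for `L ≥ 43 250`. [folklore] -/
private theorem log_L_pos {L : ℝ} (hL : 43250 ≤ L) : 0 < Real.log L :=
  Real.log_pos (by linarith)

end Lines

/-! ## 4. The world's real zeros, once more -/

section World

variable {D : ℕ} {χ : DirichletCharacter ℂ D} (hL : (43250 : ℝ) ≤ Real.log D)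
include hL

omit hL in
/-- A real zero `β` of a PRIMITIVE slot `(q, ψ)` of `W` sits at level `q = D` on the character `χ`, and
`β ∈ {β₁, 1 − β₁}`. [cite: Zhang2022LandauSiegel, §2 Assumption (A)] -/
theorem real_zero_primitive (hprim : χ.IsPrimitive) {q : ℕ} [NeZero q] {ψ : DirichletCharacter ℂ q}
    (hψ : ψ.IsPrimitive) {β : ℝ} (hz : (world D χ).IsZero q ψ β) :
    q = D ∧ IsExcSlot D χ q ψ ∧ (β = betaExc D ∨ β = 1 - betaExc D) := by
  obtain ⟨hs, hβ⟩ := (isZero_ofReal_iff χ).1 hz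
  exact ⟨hs.level_eq hprim hψ, hs, hβ⟩

/-- `√D = e^{𝓛/2}` and the two floor shapes: `c/√D = c·e^{−𝓛/2}`. [cite: Zhang2022LandauSiegel, §2 (2.1)] -/
theorem div_sqrt_eq (c : ℝ) : c / Real.sqrt D = c * Real.exp (-(Real.log D / 2)) := by
  rw [sqrt_cast_eq_exp hL, Real.exp_neg, div_eq_mul_inv]

/-- Every real zero `β` of a primitive slot has `1 − β ≥ δ(𝓛)`: it is `β₁ = 1 − δ` or `1 − β₁` (then `1 − β = β₁ > ½ > δ`).
[cite: Zhang2022LandauSiegel, §2 Assumption (A)] -/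
theorem delta_le_one_sub_of_real_zero (hprim : χ.IsPrimitive) {q : ℕ} [NeZero q] {ψ : DirichletCharacter ℂ q}
    (hψ : ψ.IsPrimitive) {β : ℝ} (hz : (world D χ).IsZero q ψ β) :
    DHMenuLines.delta (Real.log D) ≤ 1 - β := by
  obtain ⟨-, -, hβ⟩ := real_zero_primitive hprim hψ hz
  rcases hβ with rfl | rfl
  · rw [one_sub_betaExc]
  · have h1 := half_lt_betaExc hL
    have h2 := delta_lt_half hL
    linarith

end World

/-! ## 5. The rows on the world -/

section Rows

variable {D : ℕ} {χ : DirichletCharacter ℂ D} (hL : (43250 : ℝ) ≤ Real.log D)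
include hL

/-- **Census row 1 on `W`** (Ralaivaosaona–Razakarinoro Thm 1). [cite: RalaivaosaonaRazakarinoro2026, Theorem 1] -/
theorem world_rowRR1 (hprim : χ.IsPrimitive) : ∀ (d : ℕ) [NeZero d], 300000000 < d → ∀ ψ : DirichletCharacter ℂ d,
    ψ.IsQuadratic → ψ.IsPrimitive → ψ.Odd →
      ∀ β : ℝ, 0 < β → (world D χ).IsZero d ψ β → 6.035 / Real.sqrt d < 1 - β := by
  intro d _ _ ψ _ hψ _ β _ hz
  obtain ⟨rfl, -, -⟩ := real_zero_primitive hprim hψ hz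
  have hδ := delta_le_one_sub_of_real_zero hL hprim hψ hz
  rw [div_sqrt_eq hL]
  have := const_mul_exp_neg_lt_delta hL (by norm_num : (0 : ℝ) < 6.035) (by norm_num)
  linarith

omit hL in
/-- **Census row 2 on `W`** (Khale's explicit VK region, `|t| ≥ 10`): such zeros of `W` are fence points, `Re = ½`, while the
region starts right of `1 − 1/(10.5 log 3) > ½`. [cite: Khale2024, Theorem 1.1 (1.2)] -/
theorem world_rowKhale : ∀ (q : ℕ) [NeZero q], 3 ≤ q → ∀ (ψ : DirichletCharacter ℂ q) (s : ℂ), 10 ≤ |s.im| →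
    1 - 1 / (10.5 * Real.log q +
        61.5 * Real.log |s.im| ^ (2 / 3 : ℝ) * Real.log (Real.log |s.im|) ^ (1 / 3 : ℝ)) ≤ s.re →
      ¬ (world D χ).IsZero q ψ s := by
  intro q _ hq ψ s hs hre hz
  rw [isZero_world_iff] at hz
  rcases hz with hf | ⟨-, hp⟩
  · have hre' : s.re = 1 / 2 := fence_re hf
    have hq3 : (3 : ℝ) ≤ q := by exact_mod_cast hq
    have hlogq : 1 < Real.log (q : ℝ) := lt_of_lt_of_le one_lt_log_three (Real.log_le_log (by norm_num) hq3)
    have ht : 1 < Real.log |s.im| := lt_of_lt_of_le one_lt_log_three (Real.log_le_log (by norm_num) (by linarith))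
    have hA : 0 ≤ Real.log |s.im| ^ (2 / 3 : ℝ) := Real.rpow_nonneg (by linarith) _
    have hB : 0 ≤ Real.log (Real.log |s.im|) ^ (1 / 3 : ℝ) := Real.rpow_nonneg (Real.log_nonneg ht.le) _
    have hden : 2 < 10.5 * Real.log q +
        61.5 * Real.log |s.im| ^ (2 / 3 : ℝ) * Real.log (Real.log |s.im|) ^ (1 / 3 : ℝ) := by nlinarith
    have hpos : 0 < 10.5 * Real.log q +
        61.5 * Real.log |s.im| ^ (2 / 3 : ℝ) * Real.log (Real.log |s.im|) ^ (1 / 3 : ℝ) := by linarith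
    have hlt : 1 / (10.5 * Real.log q +
        61.5 * Real.log |s.im| ^ (2 / 3 : ℝ) * Real.log (Real.log |s.im|) ^ (1 / 3 : ℝ)) < 1 / 2 := by
      rw [div_lt_div_iff₀ hpos (by norm_num)]; linarith
    linarith
  · have him := im_of_mem_excPair hp
    rw [him, abs_zero] at hs
    linarith

/-- **Census row 9 on `W`** (Basak–Pratt's conditional Page theorem): the conclusion holds outright at every `Q` — two distinct
primitive quadratic characters of `W` cannot both have a real zero (both slots would be `(D, χ)`). [cite: BasakPratt2026, Theorem 1.2] -/
theorem world_atMostOneRealZeroNear (hprim : χ.IsPrimitive) (Q v : ℝ) : (world D χ).atMostOneRealZeroNear Q v := by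
  refine ⟨?_, ?_⟩
  · intro q₁ q₂ _ _ χ₁ χ₂ hne _ _ _ h1p _ h2p β₁ β₂ hz₁ hz₂ _ _
    obtain ⟨rfl, -, -⟩ := real_zero_primitive hprim h1p hz₁
    obtain ⟨h, -, -⟩ := real_zero_primitive hprim h2p hz₂
    exact absurd h.symm hne
  · intro q _ χ₁ χ₂ hne _ _ h1p _ h2p β₁ β₂ hz₁ hz₂ _ _
    obtain ⟨-, hs₁, -⟩ := real_zero_primitive hprim h1p hz₁
    obtain ⟨-, hs₂, -⟩ := real_zero_primitive hprim h2p hz₂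
    exact absurd (hs₁.eq_of_eq hs₂) hne

/-- **Census row 9 on `W`, verbatim shape** with `Q₉ := 1`. [cite: BasakPratt2026, Theorem 1.2] -/
theorem world_rowBP12 (hprim : χ.IsPrimitive) : ∀ ν : ℝ → ℝ, (∀ x, 0 < ν x) → Tendsto ν atTop (nhds 0) →
    MonotoneOn (BasakPratt2026.growth ν) (Set.Ioi 1) → Tendsto (BasakPratt2026.growth ν) atTop atTop →
    ∀ ε : ℝ, 0 < ε → ∀ Q : ℝ, (fun _ _ => (1 : ℝ)) ν ε ≤ Q →
      (world D χ).shrinkingDiskRealZeros (BasakPratt2026.growth ν) (Q ^ 2) →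
        (world D χ).atMostOneRealZeroNear Q (Real.log Q ^ (-ε)) :=
  fun _ _ _ _ _ ε _ Q _ _ => world_atMostOneRealZeroNear hL hprim Q (Real.log Q ^ (-ε))

/-- A floor `c/√D` or `c·log D/√D` with an admissible constant is `≤ 1 − β` for every real zero of a primitive slot.
[cite: GoldfeldSchinzel1975, Corollary p. 572] -/
theorem floor_le_one_sub (hprim : χ.IsPrimitive) {q : ℕ} [NeZero q] {ψ : DirichletCharacter ℂ q} (hψ : ψ.IsPrimitive)
    {β : ℝ} (hz : (world D χ).IsZero q ψ β) {c : ℝ} (hc : c ≤ 20) : c / Real.sqrt q < 1 - β := by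
  obtain ⟨rfl, -, -⟩ := real_zero_primitive hprim hψ hz
  have hδ := delta_le_one_sub_of_real_zero hL hprim hψ hz
  rw [div_sqrt_eq hL]
  by_cases hc0 : 0 < c
  · have := const_mul_exp_neg_lt_delta hL hc0 hc
    linarith
  · push Not at hc0
    have h1 : c * Real.exp (-(Real.log q / 2)) ≤ 0 := mul_nonpos_of_nonpos_of_nonneg hc0 (Real.exp_pos _).le
    have h2 : 0 < DHMenuLines.delta (Real.log q) := DHMenuLines.delta_pos (by linarith)
    linarith

/-- The `log`-weighted floor. [cite: GoldfeldSchinzel1975, Corollary p. 572] -/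
theorem logFloor_le_one_sub (hprim : χ.IsPrimitive) {q : ℕ} [NeZero q] {ψ : DirichletCharacter ℂ q} (hψ : ψ.IsPrimitive)
    {β : ℝ} (hz : (world D χ).IsZero q ψ β) {c : ℝ} (hc : c ≤ 12) : c * Real.log q / Real.sqrt q < 1 - β := by
  obtain ⟨rfl, -, -⟩ := real_zero_primitive hprim hψ hz
  have hδ := delta_le_one_sub_of_real_zero hL hprim hψ hz
  rw [div_sqrt_eq hL]
  by_cases hc0 : 0 < c
  · have := const_mul_L_mul_exp_neg_lt_delta hL hc0 hc
    linarith
  · push Not at hc0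
    have hlog : 0 ≤ Real.log (q : ℝ) := by linarith
    have h1 : c * Real.log q * Real.exp (-(Real.log q / 2)) ≤ 0 :=
      mul_nonpos_of_nonpos_of_nonneg (mul_nonpos_of_nonpos_of_nonneg hc0 hlog) (Real.exp_pos _).le
    have h2 : 0 < DHMenuLines.delta (Real.log q) := DHMenuLines.delta_pos (by linarith)
    linarith

/-- **Census row 16 on `W`** (Goldfeld–Schinzel's Corollary, both parities, `c(η) := 0`). [cite: GoldfeldSchinzel1975, Corollary p. 572] -/
theorem world_rowGS75 (hprim : χ.IsPrimitive) : ∀ η : ℝ, 0 < η → ∀ (D' : ℕ) [NeZero D'], (fun _ => 0) η < D' →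
    ∀ ψ : DirichletCharacter ℂ D', ψ.IsQuadratic → ψ.IsPrimitive →
      ∀ β : ℝ, (world D χ).IsZero D' ψ (β : ℂ) →
        (ψ.Odd → (6 / Real.pi - η) / Real.sqrt D' ≤ 1 - β) ∧
        (ψ.Even → (6 / Real.pi ^ 2 - η) * Real.log D' / Real.sqrt D' ≤ 1 - β) := by
  intro η hη D' _ _ ψ _ hψ β hz
  have hπ : 3 < Real.pi := Real.pi_gt_three
  have hc1 : 6 / Real.pi - η ≤ 20 := by
    have : 6 / Real.pi < 2 := by rw [div_lt_iff₀ (by linarith)]; linarith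
    linarith
  have hc2 : 6 / Real.pi ^ 2 - η ≤ 12 := by
    have : 6 / Real.pi ^ 2 < 1 := by rw [div_lt_iff₀ (by positivity)]; nlinarith
    linarith
  exact ⟨fun _ => (floor_le_one_sub hL hprim hψ hz hc1).le, fun _ => (logFloor_le_one_sub hL hprim hψ hz hc2).le⟩

/-- **Census row 17 on `W`** (Pintz Thm 3, `D₀ := 0`). [cite: Pintz1976ElementaryII, Theorem 3 p. 277 (1.24)] -/
theorem world_rowPintz3 (hprim : χ.IsPrimitive) : ∀ ε : ℝ, 0 < ε → ∀ (D' : ℕ) [NeZero D'], (fun _ => 0) ε ≤ D' →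
    ∀ ψ : DirichletCharacter ℂ D', ψ.IsQuadratic → ψ.IsPrimitive →
      ∀ β : ℝ, (world D χ).isGreatestRealZero D' ψ β → (12 / Real.pi - ε) / Real.sqrt D' ≤ 1 - β := by
  intro ε hε D' _ _ ψ _ hψ β hβ
  have hπ : 3 < Real.pi := Real.pi_gt_three
  have hc : 12 / Real.pi - ε ≤ 20 := by
    have : 12 / Real.pi < 4 := by rw [div_lt_iff₀ (by linarith)]; linarith
    linarith
  exact (floor_le_one_sub hL hprim hψ hβ.2.1 hc).le

/-- **Census row 17 on `W`** (Schinzel's footnote, `D₀ := 0`). [cite: Pintz1976ElementaryII, footnote (2) p. 277] -/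
theorem world_rowPintz3S (hprim : χ.IsPrimitive) : ∀ ε : ℝ, 0 < ε → ∀ (D' : ℕ) [NeZero D'], (fun _ => 0) ε < D' →
    ∀ ψ : DirichletCharacter ℂ D', ψ.IsQuadratic → ψ.IsPrimitive →
      ∀ β : ℝ, (world D χ).isGreatestRealZero D' ψ β → (16 / Real.pi - ε) / Real.sqrt D' < 1 - β := by
  intro ε hε D' _ _ ψ _ hψ β hβ
  have hπ : 3 < Real.pi := Real.pi_gt_three
  have hc : 16 / Real.pi - ε ≤ 20 := by
    have : 16 / Real.pi < 6 := by rw [div_lt_iff₀ (by linarith)]; linarith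
    linarith
  exact floor_le_one_sub hL hprim hψ hβ.2.1 hc

/-- On `W`, the greatest real zero of the slot `(D, χ)` is `β₁` (the other real zero `1 − β₁` has `β₁` above it).
[cite: Pintz1976ElementaryII, Theorem 2 p. 276] -/
theorem eq_betaExc_of_isGreatestRealZero {β : ℝ} (h : (world D χ).isGreatestRealZero D χ β) : β = betaExc D := by
  haveI : NeZero D := ⟨by have := three_le_of_hL hL; omega⟩
  obtain ⟨-, hz, hmax⟩ := h
  obtain ⟨-, hβ⟩ := (isZero_ofReal_iff χ).1 hz
  rcases hβ with h | h
  · exact h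
  · exfalso
    have h1 := half_lt_betaExc hL
    have h2 := (betaExc_window hL).2
    refine hmax (betaExc D) (by rw [h]; linarith) h2 ?_
    exact (isZero_betaExc_of_exc χ isExcSlot_self).1

omit hL in
/-- The Pintz-Thm-5 bracket on `W`'s exceptional slot: with `λ = 1/(2𝓛²⁰²²)`, `1/(5λ𝓛) = (2/5)𝓛²⁰²¹`, so
`0 < log(1/(5λ𝓛)) ≤ 2021 log 𝓛` and `(𝓛 log 𝓛/log(1/(5λ𝓛)))² ≥ (𝓛/2021)² ≥ 3/4`. [cite: Pintz1976ElementaryII, Theorem 5 (1.31)] -/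
theorem pintz5_bracket {L : ℝ} (hL : 43250 ≤ L) :
    (3 : ℝ) / 4 ≤ 1 * (L * Real.log L / Real.log (1 / (5 * DHMenuLines.lam L * L))) ^ 2 := by
  have hL0 : 0 < L := by linarith
  have hlog := log_L_pos hL
  have hX : 1 / (5 * DHMenuLines.lam L * L) = 2 / 5 * L ^ 2021 := by
    unfold DHMenuLines.lam
    field_simp
  have hXpos : 1 < 2 / 5 * L ^ 2021 := by
    have : L ≤ L ^ 2021 := le_self_pow₀ (by linarith) (by norm_num)
    linarith
  have hlogX_pos : 0 < Real.log (2 / 5 * L ^ 2021) := Real.log_pos hXpos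
  have hlogX_le : Real.log (2 / 5 * L ^ 2021) ≤ 2021 * Real.log L := by
    rw [Real.log_mul (by norm_num) (by positivity), Real.log_pow]
    have : Real.log (2 / 5 : ℝ) < 0 := Real.log_neg (by norm_num) (by norm_num)
    push_cast
    linarith
  rw [hX, one_mul]
  have hratio : L / 2021 ≤ L * Real.log L / Real.log (2 / 5 * L ^ 2021) := by
    rw [div_le_div_iff₀ (by norm_num) hlogX_pos]
    nlinarith
  have h21 : (21 : ℝ) ≤ L / 2021 := by rw [le_div_iff₀ (by norm_num)]; linarith
  nlinarith

/-- **Census row 17 on `W`** (Pintz Thm 5, `C := 1`, `D₀ := 3`). [cite: Pintz1976ElementaryII, Theorem 5 pp. 278–279 (1.30)–(1.31)] -/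
theorem world_rowPintz5 (hprim : χ.IsPrimitive) : ∀ (D' : ℕ) [NeZero D'], 3 ≤ D' →
    ∀ ψ : DirichletCharacter ℂ D', ψ.IsQuadratic → ψ.IsPrimitive →
      (world D χ).LOne D' ψ ≤ 1 / Real.log D' ^ 2 →
        (∃ β : ℝ, 1 - 1 / Real.log D' ≤ β ∧ β < 1 ∧ (world D χ).IsZero D' ψ (β : ℂ)) ∧
        ∀ β : ℝ, (world D χ).isGreatestRealZero D' ψ β →
          (world D χ).LOne D' ψ / (1 - β) ≤
            1 * (Real.log D' * Real.log (Real.log D') /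
                  Real.log (1 / (5 * (world D χ).LOne D' ψ * Real.log D'))) ^ 2 := by
  intro D' _ hD' ψ _ hψ hval
  -- the hypothesis `LOne ≤ 1/log² D'` singles out an induced slot: elsewhere `LOne = 1 > 1/log² D'`
  have hs : IsExcSlot D χ D' ψ := by
    by_contra hns
    rw [world_LOne, if_neg hns] at hval
    have hq3 : (3 : ℝ) ≤ D' := by exact_mod_cast hD'
    have hlog : 1 < Real.log (D' : ℝ) := lt_of_lt_of_le one_lt_log_three (Real.log_le_log (by norm_num) hq3)
    have : 1 < Real.log (D' : ℝ) ^ 2 := by nlinarith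
    have h2 : 1 / Real.log (D' : ℝ) ^ 2 < 1 := by rw [div_lt_one (by linarith)]; exact this
    linarith
  obtain rfl : D = D' := (hs.level_eq hprim hψ).symm
  obtain rfl : χ = ψ := hs.eq_self.symm
  have hLOne : (world D χ).LOne D χ = DHMenuLines.lam (Real.log D) := by
    rw [world_LOne, if_pos isExcSlot_self, lam_eq_lines]
  refine ⟨⟨betaExc D, ?_, (betaExc_window hL).2, (isZero_betaExc_of_exc χ isExcSlot_self).1⟩, ?_⟩
  · -- `β₁ = 1 − δ ≥ 1 − 1/𝓛` since `δ < 1/(10𝓛)`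
    have hb := DHMenuLines.bgtz_binder hL
    have hL0 : (0 : ℝ) < Real.log D := by linarith
    have h10 : 1 / (10 * Real.log D) ≤ 1 / Real.log D :=
      div_le_div_of_nonneg_left (by norm_num) hL0 (by linarith)
    have : betaExc D = 1 - DHMenuLines.delta (Real.log D) := by rw [← one_sub_betaExc]; ring
    rw [this]; linarith
  · intro β hβ
    have hβ₁ := eq_betaExc_of_isGreatestRealZero hL hβ
    subst hβ₁
    rw [hLOne, one_sub_betaExc]
    rw [show DHMenuLines.lam (Real.log D) / DHMenuLines.delta (Real.log D) = 3 / 4 by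
      rw [DHMenuLines.delta_eq_lam_div]
      have := DHMenuLines.lam_pos (show (0:ℝ) < Real.log D by linarith)
      field_simp
      norm_num]
    exact pintz5_bracket hL

end Rows

/-! ## 6. The theorem -/

/-- **E-18e DISCHARGED: `MenuCensusConsistent` holds** — the (A)-world `W(D, χ)` meets every census row that is typed in
tree and reads on its fields, for every `log D ≥ 43 250`, with the thresholds/constants `c₁₆ := 0`, `D₃ = D₃' := 0`,
`C₅ := 1`, `D₅ := 3`, `Q₉ := 1` chosen once. A COMPANION outside the word's scope; census rows are term-(iii) watch rows.
«The programme SEARCHES and TYPES; no claim about Landau–Siegel zeros, Theorems 1–2 of arXiv:2211.02515 or a repaired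
Margin232 until a kernel theorem says so.» [cite: Zhang2022LandauSiegel, §2 Assumption (A)] -/
theorem menuCensusConsistent_holds : MenuCensusConsistent := by
  refine ⟨fun _ => 0, fun _ => 0, fun _ => 0, 1, 3, fun _ _ => 1, fun _ _ => le_rfl, ?_⟩
  intro D _ χ hprim _ _ hL
  exact
    { rowRR1 := world_rowRR1 hL hprim
      rowKhale := world_rowKhale
      rowBP12 := world_rowBP12 hL hprim
      rowGS75 := world_rowGS75 hL hprim
      rowPintz3 := world_rowPintz3 hL hprim
      rowPintz3S := world_rowPintz3S hL hprim
      rowPintz5 := world_rowPintz5 hL hprim }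

/-- The referee's C2 probe (REF-E §0b): the proved type is the definition BY NAME. [cite: Zhang2022LandauSiegel, §2 Assumption (A)] -/
example : Literature.NumberTheory.LFunctions.Zhang2022.DH.MenuCensusConsistent := menuCensusConsistent_holds

/-! ## 7. Part 2 — census row 18 (`pintz1976_theorem4`, the prime-value row), MET by Skolem choice

Row 18 reads, besides the world's value field (`(L(1,χ)).re ↦ w.LOne`), the sum `Σ_{p ≤ D², p prime} (1 + Re χ(p))/p` over
the TRUE primes and the TRUE values of the character `χ` (the datum of the world, a genuine Dirichlet character) — exactly as
typed. On `W` the hypothesis `LOne ≤ 1/log²D'` singles out the induced slot `(D, χ)` (`LOne = λ`), and the row is MET for the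
Skolem constant `C := 4e⁸·2021²` by Mertens' elementary bound `Σ_{p ≤ N} 1/p ≤ log log N + 4`
(`MertensBound.sum_inv_prime_le`, PROVED in tree): `exp(Σ) ≤ exp(2 log log D² + 8) = 4e⁸𝓛²` while
`C·(𝓛 log 𝓛/log(1/(5λ𝓛)))² ≥ C·(𝓛/2021)² = 4e⁸𝓛²`. (The census's own remark stands: with Pintz's actual constant the row
would speak about the bias `χ_D(p) = −1` of the ACTUAL character; as an `∃C`-row it is met by every world.) -/

namespace ZeroWorld

/-- **Census row 18 over a world** (`pintz1976_theorem4` read verbatim; its `∃ C ∃ D₀` are the parameters `C₄, D₄`;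
`(L(1,χ)).re ↦ w.LOne`; the prime sum is over the true primes and character values).
[cite: Pintz1976ElementaryII, Theorem 4 pp. 277–278 (1.25)–(1.26)] -/
structure MenuCensusRow18 (w : ZeroWorld) (C₄ : ℝ) (D₄ : ℕ) : Prop where
  /-- census row 18 = `pintz1976_theorem4`. -/
  rowPintz4 : ∀ (D' : ℕ) [NeZero D'], D₄ ≤ D' →
    ∀ χ : DirichletCharacter ℂ D', χ.IsQuadratic → χ.IsPrimitive →
      w.LOne D' χ ≤ 1 / Real.log D' ^ 2 →
        Real.exp (∑ p ∈ (Finset.range (D' ^ 2 + 1)).filter Nat.Prime, (1 + (χ (p : ZMod D')).re) / p) ≤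
          C₄ * (Real.log D' * Real.log (Real.log D') /
                Real.log (1 / (5 * w.LOne D' χ * Real.log D'))) ^ 2

end ZeroWorld

/-- **`MenuCensusRow18Consistent`**: there are `C₄, D₄`, chosen ONCE, such that `world D χ` meets census row 18 for every
`log D ≥ 43 250` and every primitive quadratic `χ ≠ χ₀` mod `D`. A COMPANION outside the word's scope (term-(iii) watch row).
[cite: Zhang2022LandauSiegel, §2 Assumption (A)] -/
def MenuCensusRow18Consistent : Prop :=
  ∃ C₄ : ℝ, ∃ D₄ : ℕ, ∀ (D : ℕ) [NeZero D] (χ : DirichletCharacter ℂ D), χ.IsPrimitive → χ.IsQuadratic → χ ≠ 1 →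
    (43250 : ℝ) ≤ Real.log D → (world D χ).MenuCensusRow18 C₄ D₄

section Row18

variable {D : ℕ} {χ : DirichletCharacter ℂ D} (hL : (43250 : ℝ) ≤ Real.log D)
include hL

omit hL in
/-- Pintz's prime sum is at most `2·Σ_{p ≤ D²} 1/p ≤ 2(log log D² + 4)` (`|Re χ(p)| ≤ 1`, Mertens).
[cite: HardyWright2008, Thm 427 (§22.7, book p. 464)] -/
theorem pintz_sum_le (hD : 2 ≤ D) (ψ : DirichletCharacter ℂ D) :
    ∑ p ∈ (Finset.range (D ^ 2 + 1)).filter Nat.Prime, (1 + (ψ (p : ZMod D)).re) / p ≤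
      2 * (Real.log (Real.log ((D : ℝ) ^ 2)) + 4) := by
  have hset : (Finset.range (D ^ 2 + 1)).filter Nat.Prime = Nat.primesLE (D ^ 2) := by
    simp [Nat.primesLE, Nat.primesBelow]
  rw [hset]
  have hD2 : 2 ≤ D ^ 2 := le_trans hD (Nat.le_self_pow (by norm_num) D)
  have hM := MertensBound.sum_inv_prime_le (D ^ 2) hD2
  have hterm : ∀ p ∈ Nat.primesLE (D ^ 2), (1 + (ψ (p : ZMod D)).re) / p ≤ 2 * ((1 : ℝ) / p) := by
    intro p hp
    have hre : (ψ (p : ZMod D)).re ≤ 1 := (Complex.re_le_norm _).trans (DirichletCharacter.norm_le_one ψ _)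
    have hp0 : (0 : ℝ) ≤ p := Nat.cast_nonneg p
    rw [show 2 * ((1 : ℝ) / p) = 2 / p by ring]
    exact div_le_div_of_nonneg_right (by linarith) hp0
  calc ∑ p ∈ Nat.primesLE (D ^ 2), (1 + (ψ (p : ZMod D)).re) / p
      ≤ ∑ p ∈ Nat.primesLE (D ^ 2), 2 * ((1 : ℝ) / p) := Finset.sum_le_sum hterm
    _ = 2 * ∑ p ∈ Nat.primesLE (D ^ 2), (1 : ℝ) / p := by rw [Finset.mul_sum]
    _ ≤ 2 * (Real.log (Real.log ((D : ℝ) ^ 2)) + 4) := by push_cast at hM ⊢; nlinarith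

omit hL in
/-- The bracket of Pintz's Theorems 4/5 on `W`'s exceptional slot: `𝓛/2021 ≤ 𝓛 log 𝓛/log(1/(5λ𝓛))`, `λ = 1/(2𝓛²⁰²²)`.
[cite: Pintz1976ElementaryII, Theorem 4 (1.26)] -/
theorem bracket_ge {L : ℝ} (hL : 43250 ≤ L) :
    L / 2021 ≤ L * Real.log L / Real.log (1 / (5 * DHMenuLines.lam L * L)) := by
  have hL0 : 0 < L := by linarith
  have hlog : 0 < Real.log L := Real.log_pos (by linarith)
  have hX : 1 / (5 * DHMenuLines.lam L * L) = 2 / 5 * L ^ 2021 := by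
    unfold DHMenuLines.lam
    field_simp
  have hXpos : 1 < 2 / 5 * L ^ 2021 := by
    have : L ≤ L ^ 2021 := le_self_pow₀ (by linarith) (by norm_num)
    linarith
  have hlogX_pos : 0 < Real.log (2 / 5 * L ^ 2021) := Real.log_pos hXpos
  have hlogX_le : Real.log (2 / 5 * L ^ 2021) ≤ 2021 * Real.log L := by
    rw [Real.log_mul (by norm_num) (by positivity), Real.log_pow]
    have : Real.log (2 / 5 : ℝ) < 0 := Real.log_neg (by norm_num) (by norm_num)
    push_cast
    linarith
  rw [hX, div_le_div_iff₀ (by norm_num) hlogX_pos]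
  nlinarith

/-- **Census row 18 on `W`** (`C₄ := 4e⁸·2021²`, `D₄ := 3`). [cite: Pintz1976ElementaryII, Theorem 4 pp. 277–278 (1.25)–(1.26)] -/
theorem world_rowPintz4 (hprim : χ.IsPrimitive) : ∀ (D' : ℕ) [NeZero D'], 3 ≤ D' →
    ∀ ψ : DirichletCharacter ℂ D', ψ.IsQuadratic → ψ.IsPrimitive →
      (world D χ).LOne D' ψ ≤ 1 / Real.log D' ^ 2 →
        Real.exp (∑ p ∈ (Finset.range (D' ^ 2 + 1)).filter Nat.Prime, (1 + (ψ (p : ZMod D')).re) / p) ≤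
          (4 * Real.exp 8 * 2021 ^ 2) * (Real.log D' * Real.log (Real.log D') /
                Real.log (1 / (5 * (world D χ).LOne D' ψ * Real.log D'))) ^ 2 := by
  intro D' _ hD' ψ _ hψ hval
  have hs : IsExcSlot D χ D' ψ := by
    by_contra hns
    rw [world_LOne, if_neg hns] at hval
    have hq3 : (3 : ℝ) ≤ D' := by exact_mod_cast hD'
    have hlog : 1 < Real.log (D' : ℝ) := lt_of_lt_of_le one_lt_log_three (Real.log_le_log (by norm_num) hq3)
    have : 1 < Real.log (D' : ℝ) ^ 2 := by nlinarith
    have h2 : 1 / Real.log (D' : ℝ) ^ 2 < 1 := by rw [div_lt_one (by linarith)]; exact this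
    linarith
  obtain rfl : D = D' := (hs.level_eq hprim hψ).symm
  obtain rfl : χ = ψ := hs.eq_self.symm
  rw [world_LOne, if_pos isExcSlot_self, lam_eq_lines]
  set L := Real.log (D : ℝ) with hLdef
  have hL0 : 0 < L := by linarith
  -- the prime sum
  have hsum := pintz_sum_le (by omega : 2 ≤ D) χ
  have hD0 : (0 : ℝ) < D := by exact_mod_cast (by omega : 0 < D)
  have hlog2 : Real.log (Real.log ((D : ℝ) ^ 2)) = Real.log 2 + Real.log L := by
    rw [Real.log_pow, Nat.cast_ofNat, hLdef, Real.log_mul (by norm_num) hL0.ne']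
  rw [hlog2] at hsum
  have hexp : Real.exp (∑ p ∈ (Finset.range (D ^ 2 + 1)).filter Nat.Prime, (1 + (χ (p : ZMod D)).re) / p) ≤
      4 * Real.exp 8 * L ^ 2 := by
    calc Real.exp (∑ p ∈ (Finset.range (D ^ 2 + 1)).filter Nat.Prime, (1 + (χ (p : ZMod D)).re) / p)
        ≤ Real.exp (2 * (Real.log 2 + Real.log L + 4)) := Real.exp_le_exp.mpr hsum
      _ = 4 * Real.exp 8 * L ^ 2 := by
          have h1 : Real.exp (2 * Real.log 2) = 4 := by
            rw [show (2 : ℝ) * Real.log 2 = ((2 : ℕ) : ℝ) * Real.log 2 by norm_num, Real.exp_nat_mul,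
              Real.exp_log (by norm_num)]
            norm_num
          have h2 : Real.exp (2 * Real.log L) = L ^ 2 := by
            rw [show (2 : ℝ) * Real.log L = ((2 : ℕ) : ℝ) * Real.log L by norm_num, Real.exp_nat_mul,
              Real.exp_log hL0]
          rw [show 2 * (Real.log 2 + Real.log L + 4) = 2 * Real.log 2 + 2 * Real.log L + 8 by ring,
            Real.exp_add, Real.exp_add, h1, h2]
          ring
  -- the bracket
  have hbr := bracket_ge hL
  have hbr0 : 0 ≤ L / 2021 := by positivity
  have hsq : (L / 2021) ^ 2 ≤ (L * Real.log L / Real.log (1 / (5 * DHMenuLines.lam L * L))) ^ 2 :=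
    pow_le_pow_left₀ hbr0 hbr 2
  calc Real.exp (∑ p ∈ (Finset.range (D ^ 2 + 1)).filter Nat.Prime, (1 + (χ (p : ZMod D)).re) / p)
      ≤ 4 * Real.exp 8 * L ^ 2 := hexp
    _ = (4 * Real.exp 8 * 2021 ^ 2) * (L / 2021) ^ 2 := by ring
    _ ≤ (4 * Real.exp 8 * 2021 ^ 2) * (L * Real.log L / Real.log (1 / (5 * DHMenuLines.lam L * L))) ^ 2 :=
        mul_le_mul_of_nonneg_left hsq (by positivity)

end Row18

/-- **Census row 18 DISCHARGED on `W`**: `MenuCensusRow18Consistent` holds with `C₄ := 4e⁸·2021²`, `D₄ := 3`.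
«The programme SEARCHES and TYPES; no claim about Landau–Siegel zeros, Theorems 1–2 of arXiv:2211.02515 or a repaired
Margin232 until a kernel theorem says so.» [cite: Zhang2022LandauSiegel, §2 Assumption (A)] -/
theorem menuCensusRow18Consistent_holds : MenuCensusRow18Consistent :=
  ⟨4 * Real.exp 8 * 2021 ^ 2, 3, fun _ _ _ hprim _ _ hL => ⟨world_rowPintz4 hL hprim⟩⟩

/-- `MenuCensusRow18Consistent` — `_holds` alias of `menuCensusRow18Consistent_holds` above under the fact's exact name (appended
2026-08-28, D-0026 bookkeeping: the proof term is the existing theorem of this file; no statement,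
definition or attribute is edited; no new named fact; the ledger's debt table listed the fact
unproved). [cite: Zhang2022LandauSiegel, §2 Assumption (A)] -/
theorem _root_.Literature.NumberTheory.LFunctions.Zhang2022.DH.MenuCensusRow18Consistent_holds :
    MenuCensusRow18Consistent :=
  _root_.Literature.NumberTheory.LFunctions.Zhang2022.DH.menuCensusRow18Consistent_holds

/-- C2 probe. [cite: Zhang2022LandauSiegel, §2 Assumption (A)] -/
example : Literature.NumberTheory.LFunctions.Zhang2022.DH.MenuCensusRow18Consistent := menuCensusRow18Consistent_holds

end Literature.NumberTheory.LFunctions.Zhang2022.DH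

end
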